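import Mathlib
import Literature.Combinatorics.Optimization.CorrelationPolytopeGridMinor
import Summits.ValiantsHypothesis.ValiantsHypothesis.Theorems.FifoMatchingGridCorShadowFaceLift
import HarnessLib

/-!
# HY21 Proposition 19: the `2^h` vertices of `COR(K_h)` have a planar shadow in convex position — Theorems-side port

Port to `Theorems/` (director-valiant g12 R180 (b)(i): val-port-2 = S-port hand) of § Prop19 of val-idea-7 g7's
kernel-checked line workfile `Cruxes/NNLinearDegreeCofactorHard/Lines/shadow_division.lean` rev 5b, stated WITHOUT
definitions: the parabola map `x ↦ (Σ_i 2^i x_ii, Σ_{i,j} 2^{i+j} x_ij)` of [HrubesYehudayoff2021, Prop. 19 p.10] is built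
inside the proof and the theorem `clique_parabola_shadow` only asserts the EXISTENCE of a linear map
`Λ : ℝ^{h×h} → ℝ²` under which the `2^h` generating vectors `corVec ⊤ b` of the correlation polytope `COR(K_h)`
(`Literature.Combinatorics.Optimization.corVec`, AFHMS 2019 §1) go to `2^h` points in strictly convex position (the
vertex of `b` goes to `(N_b, N_b²)`, `N_b = Σ_i 2^i b_i`, and distinct points of a parabola are vertices of their hull) —
that existential is exactly what the transfer G♭ ⇒ G (`gridCorShadowHard_of_cliqueFace`, sibling file) consumes.

Also here: `corVec_top` (the clique's correlation vectors are `b_i b_j`), the binary-value recursion/injectivity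
`binVal_succ` / `binVal_injective`, and `convexHull_inter_face` (the face of a hull cut out by a valid inequality is the
hull of the points on it — used by G♭ ⇒ G to read the AFHMS face).

HONEST FRAMING: helper/port layer of an OPEN line (inputs A1 `QueueGridZeroOnePoints`, G♭ `Theses.FifoMatching.GridCorCliqueFace`
= stmt-27045 OPEN; K1 stmt-26254 closed only conditionally); no rung of record moves; nothing here bears on `VP ≠ VNP`,
which is NOT proved.
-/

set_option autoImplicit false

-- the mandated summit-side namespace repeats a component by design (single-problem summit)
set_option linter.dupNamespace false

namespace Summit.ValiantsHypothesis.ValiantsHypothesis.Theorems.FifoMatching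

namespace GridCorShadow

open Literature.Combinatorics.Optimization (corVec corPolytopeGraph)

/-- the face of a hull cut out by a valid inequality is the hull of the points on it. [folklore] -/
theorem convexHull_inter_face {E : Type*} [AddCommGroup E] [Module ℝ E] (S : Set E)
    (w : E →ₗ[ℝ] ℝ) (w₀ : ℝ) (hvalid : ∀ x ∈ S, w x ≤ w₀) :
    convexHull ℝ S ∩ {x | w x = w₀} = convexHull ℝ (S ∩ {x | w x = w₀}) := by
  classical
  apply Set.Subset.antisymm
  · rintro x ⟨hx, hxw⟩
    rw [_root_.convexHull_eq] at hx
    obtain ⟨κ, t, c, z, hc0, hc1, hz, rfl⟩ := hx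
    have hcm : t.centerMass c z = ∑ i ∈ t, c i • z i := Finset.centerMass_eq_of_sum_1 _ _ hc1
    have hwx : w (t.centerMass c z) = ∑ i ∈ t, c i * w (z i) := by
      rw [hcm, map_sum]; simp [map_smul, smul_eq_mul]
    have hle : ∀ i ∈ t, c i * w (z i) ≤ c i * w₀ := fun i hi =>
      mul_le_mul_of_nonneg_left (hvalid _ (hz i hi)) (hc0 i hi)
    have hsum0 : ∑ i ∈ t, c i * w₀ = w₀ := by rw [← Finset.sum_mul, hc1, one_mul]
    have heq : ∀ i ∈ t, c i * w (z i) = c i * w₀ := by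
      rw [← Finset.sum_eq_sum_iff_of_le hle]
      rw [← hwx, hsum0]; exact hxw
    have hface : ∀ i ∈ t, c i ≠ 0 → w (z i) = w₀ := fun i hi hci =>
      mul_left_cancel₀ hci (heq i hi)
    rw [← Finset.centerMass_filter_ne_zero]
    apply Finset.centerMass_mem_convexHull
    · intro i hi; exact hc0 i (Finset.mem_filter.mp hi).1
    · rw [Finset.sum_filter_ne_zero, hc1]; exact one_pos
    · intro i hi
      obtain ⟨hit, hci⟩ := Finset.mem_filter.mp hi
      exact ⟨hz i hit, hface i hit hci⟩
  · apply convexHull_min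
    · rintro x ⟨hxS, hxw⟩
      exact ⟨subset_convexHull ℝ S hxS, hxw⟩
    · intro x hx y hy a b ha hb hab
      refine ⟨(convex_convexHull ℝ S) hx.1 hy.1 ha hb hab, ?_⟩
      show w (a • x + b • y) = w₀
      have h1 : w x = w₀ := hx.2
      have h2 : w y = w₀ := hy.2
      rw [map_add, map_smul, map_smul, h1, h2, smul_eq_mul, smul_eq_mul, ← add_mul, hab, one_mul]

/-- binary value of a bit vector, recursion on the first bit: `N(b) = b₀ + 2·N(b ∘ succ)`. -/
theorem binVal_succ {h : ℕ} (b : Fin (h + 1) → Bool) :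
    (∑ i : Fin (h + 1), if b i then 2 ^ (i : ℕ) else 0) =
      (if b 0 then 1 else 0) + 2 * ∑ i : Fin h, if b i.succ then 2 ^ (i : ℕ) else 0 := by
  rw [Fin.sum_univ_succ, Finset.mul_sum]
  have h1 : (if b 0 = true then 2 ^ ((0 : Fin (h + 1)) : ℕ) else 0) = if b 0 = true then 1 else 0 := by simp
  have h2 : ∀ i : Fin h, (if b i.succ = true then 2 ^ ((i.succ : Fin (h + 1)) : ℕ) else 0)
      = 2 * (if b i.succ = true then 2 ^ (i : ℕ) else 0) := by
    intro i; by_cases hb : b i.succ <;> simp [hb, Fin.val_succ, pow_succ, mul_comm]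
  rw [h1]
  exact congrArg _ (Finset.sum_congr rfl fun i _ => h2 i)

/-- the binary value `b ↦ Σ_i 2^i b_i` is injective on bit vectors. -/
theorem binVal_injective :
    ∀ h : ℕ, Function.Injective (fun b : Fin h → Bool => ∑ i : Fin h, if b i then 2 ^ (i : ℕ) else 0)
  | 0 => fun b b' _ => funext fun i => i.elim0
  | h + 1 => by
      intro b b' heq
      simp only at heq
      rw [binVal_succ b, binVal_succ b'] at heq
      have h0 : b 0 = b' 0 := by
        have := congrArg (· % 2) heq
        cases hb : b 0 <;> cases hb' : b' 0 <;> simp [hb, hb'] at this ⊢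
      have htail : (∑ i : Fin h, if b i.succ then 2 ^ (i : ℕ) else 0) =
          ∑ i : Fin h, if b' i.succ then 2 ^ (i : ℕ) else 0 := by
        rw [h0] at heq; omega
      have ih := binVal_injective h htail
      funext i
      refine Fin.cases h0 (fun j => ?_) i
      exact congrFun ih j

/-- the correlation vectors of the complete graph: `(corVec ⊤ b)_{ij} = b_i b_j`. -/
theorem corVec_top {h : ℕ} (b : Fin h → Bool) (p : Fin h × Fin h) :
    corVec (⊤ : SimpleGraph (Fin h)) b p = if (b p.1 && b p.2) = true then 1 else 0 := by
  unfold corVec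
  by_cases hp : p.1 = p.2
  · rw [if_pos hp, hp, Bool.and_self]
  · rw [if_neg hp, if_pos ((SimpleGraph.top_adj _ _).2 hp)]

/-- **HY21 Prop 19** [HrubesYehudayoff2021, Prop. 19 p.10]: some planar linear shadow of the `2^h` generating vectors of
`COR(K_h)` has exactly `2^h` hull vertices (the parabola map `x ↦ (Σ_i 2^i x_ii, Σ_{i,j} 2^{i+j} x_ij)` sends the vector
of `b` to `(N_b, N_b²)`). Stated as an existential so that no definition is introduced. -/
theorem clique_parabola_shadow (h : ℕ) :
    ∃ Λ : (Fin h × Fin h → ℝ) →ₗ[ℝ] (Fin 2 → ℝ),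
      (Set.extremePoints ℝ (convexHull ℝ
        (Λ '' Set.range (corVec (⊤ : SimpleGraph (Fin h)))))).ncard = 2 ^ h := by
  classical
  -- the parabola map (a proof-local structure, not a declaration)
  let Λ : (Fin h × Fin h → ℝ) →ₗ[ℝ] (Fin 2 → ℝ) :=
    { toFun := fun x => ![∑ i : Fin h, (2 : ℝ) ^ (i : ℕ) * x (i, i),
        ∑ p : Fin h × Fin h, (2 : ℝ) ^ ((p.1 : ℕ) + (p.2 : ℕ)) * x p]
      map_add' := fun x y => by
        ext j; fin_cases j <;> simp [Finset.sum_add_distrib, mul_add]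
      map_smul' := fun a x => by
        ext j; fin_cases j <;> simp [Finset.mul_sum, mul_left_comm, smul_eq_mul] }
  have hΛ : ∀ x, Λ x = ![∑ i : Fin h, (2 : ℝ) ^ (i : ℕ) * x (i, i),
      ∑ p : Fin h × Fin h, (2 : ℝ) ^ ((p.1 : ℕ) + (p.2 : ℕ)) * x p] := fun x => rfl
  refine ⟨Λ, ?_⟩
  -- binary values
  let N : (Fin h → Bool) → ℕ := fun b => ∑ i : Fin h, if b i then 2 ^ (i : ℕ) else 0
  have hNinj : Function.Injective N := binVal_injective h
  have hparab : ∀ b : Fin h → Bool,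
      Λ (corVec (⊤ : SimpleGraph (Fin h)) b) = ![(N b : ℝ), (N b : ℝ) ^ 2] := by
    intro b
    have hN : ((N b : ℕ) : ℝ) = ∑ i : Fin h, if b i then (2 : ℝ) ^ (i : ℕ) else 0 := by
      simp only [N]; push_cast; simp
    have h0 : ∑ i : Fin h, (2 : ℝ) ^ (i : ℕ) * corVec (⊤ : SimpleGraph (Fin h)) b (i, i) =
        ∑ i : Fin h, if b i then (2 : ℝ) ^ (i : ℕ) else 0 := by
      refine Finset.sum_congr rfl fun i _ => ?_
      rw [corVec_top]; cases b i <;> simp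
    have h1 : ∑ p : Fin h × Fin h, (2 : ℝ) ^ ((p.1 : ℕ) + (p.2 : ℕ)) * corVec (⊤ : SimpleGraph (Fin h)) b p =
        (∑ i : Fin h, if b i then (2 : ℝ) ^ (i : ℕ) else 0) *
          (∑ i : Fin h, if b i then (2 : ℝ) ^ (i : ℕ) else 0) := by
      rw [Finset.sum_mul_sum, ← Finset.sum_product', Finset.univ_product_univ]
      refine Finset.sum_congr rfl fun p _ => ?_
      rw [corVec_top]; cases b p.1 <;> cases b p.2 <;> simp [pow_add]
    rw [hΛ]
    ext j; fin_cases j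
    · simp [h0, hN]
    · simp [h1, hN, sq]
  set X := Λ '' Set.range (corVec (⊤ : SimpleGraph (Fin h))) with hX
  let P : (Fin h → Bool) → (Fin 2 → ℝ) := fun b => ![(N b : ℝ), (N b : ℝ) ^ 2]
  have hXP : X = Set.range P := by
    ext q; constructor
    · rintro ⟨_, ⟨b, rfl⟩, rfl⟩; exact ⟨b, (hparab b).symm⟩
    · rintro ⟨b, rfl⟩; exact ⟨_, ⟨b, rfl⟩, hparab b⟩
  have hPinj : Function.Injective P := by
    intro b b' hbb
    have h0 := congrFun hbb 0
    simp only [P, Matrix.cons_val_zero] at h0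
    exact hNinj (by exact_mod_cast h0)
  -- every point of `X` is a strict maximiser of `2 N_b x₀ − x₁`
  have hext : X ⊆ Set.extremePoints ℝ (convexHull ℝ X) := by
    rintro q ⟨_, ⟨b, rfl⟩, rfl⟩
    rw [hparab]
    let g : (Fin 2 → ℝ) →ₗ[ℝ] ℝ := (2 * (N b : ℝ)) • LinearMap.proj 0 - LinearMap.proj 1
    refine mem_extremePoints_of_strict_max X g (hXP ▸ ⟨b, rfl⟩) fun q hq hne => ?_
    rw [hXP] at hq
    obtain ⟨b', rfl⟩ := hq
    have hNN : (N b' : ℝ) ≠ (N b : ℝ) := by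
      intro hN; apply hne
      show P b' = P b
      simp only [P, hN]
    have hpos : 0 < ((N b : ℝ) - N b') ^ 2 := by
      have := sub_ne_zero.2 hNN.symm
      positivity
    simp only [g, P, LinearMap.sub_apply, LinearMap.smul_apply, LinearMap.proj_apply, Matrix.cons_val_zero,
      Matrix.cons_val_one, smul_eq_mul, Matrix.cons_val_fin_one]
    nlinarith [hpos]
  have hEq : Set.extremePoints ℝ (convexHull ℝ X) = X :=
    Set.Subset.antisymm extremePoints_convexHull_subset hext
  rw [hEq, hXP, ← Set.image_univ, Set.ncard_image_of_injective _ hPinj, Set.ncard_univ, Nat.card_eq_fintype_card]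
  simp

end GridCorShadow

end Summit.ValiantsHypothesis.ValiantsHypothesis.Theorems.FifoMatching
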